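import Mathlib
import Summits.NavierStokesRegularity.NavierStokesRegularity.Theorems.L3TimeExponentPincerEnergyLineSixTop
import HarnessLib.Audit
import HarnessLib

/-!
# L3TimeExponentPincer — the energy line is rigid in EVERY mixed norm `L^q_t L^p_x`, `p > 3`

Support kernel for the crux `L3CascadeJaw` (item stmt-NavierStokesRegularity-19499); sequel of
`…EnergyLineSixTop` (`p = 6`, `p = ∞`).  ROUND-11's `not_quantBound_above_energyLine` (seat
nsreg-p2) is conditional on an `L^p` persistence family with the energy-line floor exponent
`β_p = 3/2 - 3/p`; here that family is PRODUCED for every real `p > 3` from the `L³` ring family by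
Lyapunov interpolation of `L³` between `L²` (energy `≤ 1`) and `L^p`:

* `lintegral_rpow_three_le_interp` — `∫ F³ ≤ (∫ F²)^{(p-3)/(p-2)} (∫ F^p)^{1/(p-2)}` (Hölder with
  exponents `(p-2)/(p-3)`, `p-2`);
* `lpPersistence_of_three_lt : 3 < p → LpPersistence (ofReal p) (3/2 - 3/p) 2` — the ring family
  has `‖u(t)‖_p ≥ ‖u(t)‖₃^{3(p-2)/p} ≥ c^{3(p-2)/p} ℓ^{-(3/2 - 3/p)}` on `(0, c^{3(p-2)/p} ℓ²)`;
* `not_quantBound_of_three_lt : 3 < p → 0 < q → 2/q + 3/p < 3/2 → ¬ QuantBound (ofReal p) q` —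
  **no `(E₀, ν, T)`-uniform bound on `∫₀ᵀ ‖u‖_p^q` anywhere strictly above the energy line
  `2/q + 3/p = 3/2`, for every `p > 3`** (by `not_quantBound_above_energyLine`).

WHAT THIS IS NOT: not NS regularity or blow-up; statements about UNIFORM constants over Schwartz
data; the positive side (bounds ON the line for `3 ≤ p ≤ 6`) is the classical energy-class scale,
in the tree at `p = 3` (`quantJaw_four`) and `p = 6` (`quantBound_six_two`); the crux `L3CascadeJaw`
is untouched; no crux claim.
-/

noncomputable section

namespace Summit.NavierStokesRegularity.NavierStokesRegularity.Theorems.L3TimeExponentPincerEnergyLineAllP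

open MeasureTheory Set Filter Literature.Analysis.FluidPDE
open Summit.NavierStokesRegularity.NavierStokesRegularity.Theorems.L3TimeExponentPincerQuantJaw
open Summit.NavierStokesRegularity.NavierStokesRegularity.Theorems.L3TimeExponentPincerJawEnergyFloor
open Summit.NavierStokesRegularity.NavierStokesRegularity.Theorems.L3TimeExponentPincerCritModulus
open Summit.NavierStokesRegularity.NavierStokesRegularity.Theorems.L3TimeExponentPincerRingPersistenceHolds
open scoped ENNReal NNReal

/-- **Lyapunov interpolation of `L³` between `L²` and `L^p`** (`p > 3`), in `lintegral` form:
`∫ F³ ≤ (∫ F²)^{(p-3)/(p-2)} · (∫ F^p)^{1/(p-2)}`. -/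
theorem lintegral_rpow_three_le_interp {α : Type*} [MeasurableSpace α] (μ : Measure α)
    {F : α → ℝ≥0∞} (hF : AEMeasurable F μ) {p : ℝ} (hp : 3 < p) :
    ∫⁻ x, F x ^ (3 : ℝ) ∂μ ≤
      (∫⁻ x, F x ^ (2 : ℝ) ∂μ) ^ ((p - 3) / (p - 2)) * (∫⁻ x, F x ^ p ∂μ) ^ (1 / (p - 2)) := by
  have hp2 : 0 < p - 2 := by linarith
  have hp3 : 0 < p - 3 := by linarith
  -- Hölder exponents `r = (p-2)/(p-3)`, `r' = p-2`
  have hr : ((p - 2) / (p - 3)).HolderConjugate (p - 2) := by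
    refine Real.holderConjugate_iff.2 ⟨(one_lt_div hp3).2 (by linarith), ?_⟩
    rw [inv_div]
    field_simp
    ring
  -- split `F³ = F^a · F^(3-a)`, `a = 2(p-3)/(p-2)`
  set a : ℝ := 2 * (p - 3) / (p - 2) with ha
  have ha0 : 0 ≤ a := by positivity
  have ha3 : 0 ≤ 3 - a := by
    rw [ha, sub_nonneg, div_le_iff₀ hp2]; linarith
  have key := ENNReal.lintegral_mul_le_Lp_mul_Lq μ hr (hF.pow_const a) (hF.pow_const (3 - a))
  have elhs : (fun x => F x ^ a * F x ^ (3 - a)) = fun x => F x ^ (3 : ℝ) := by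
    funext x
    rw [← ENNReal.rpow_add_of_nonneg _ _ ha0 ha3]
    congr 1; ring
  have e1 : ∀ x, (F x ^ a) ^ ((p - 2) / (p - 3)) = F x ^ (2 : ℝ) := fun x => by
    rw [← ENNReal.rpow_mul]
    congr 1
    rw [ha]; field_simp; try ring
  have e2 : ∀ x, (F x ^ (3 - a)) ^ (p - 2) = F x ^ p := fun x => by
    rw [← ENNReal.rpow_mul]
    congr 1
    rw [ha]; field_simp; try ring
  have e3 : 1 / ((p - 2) / (p - 3)) = (p - 3) / (p - 2) := by rw [one_div, inv_div]
  simp only [Pi.mul_apply, e1, e2, e3] at key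
  rw [elhs] at key
  exact key

/-- **`L^p` persistence of the ring family for every `p > 3`**: `LpPersistence (ofReal p) (3/2 - 3/p) 2`
with constant `c^{3(p-2)/p}` (from the `L³` floor `cℓ^{-1/2}` and `∫|u(t)|² ≤ 1`:
`‖u‖₃³ ≤ ‖u‖_p^{p/(p-2)}`, i.e. `‖u‖_p ≥ ‖u‖₃^{3(p-2)/p}`). -/
theorem lpPersistence_of_three_lt {p : ℝ} (hp : 3 < p) :
    LpPersistence (ENNReal.ofReal p) (3 / 2 - 3 / p) 2 := by
  have hp0 : 0 < p := by linarith
  have hp2 : 0 < p - 2 := by linarith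
  obtain ⟨c, hc, hc1, hfam⟩ := lpPersistence_three_half_two
  -- the exponent `e = 3(p-2)/p ≥ 1`
  set e : ℝ := 3 * (p - 2) / p with he
  have he1 : 1 ≤ e := by rw [he, le_div_iff₀ hp0]; linarith
  have he0 : 0 ≤ e := zero_le_one.trans he1
  have hce : c ^ e ≤ c := by
    calc c ^ e ≤ c ^ (1 : ℝ) := Real.rpow_le_rpow_of_exponent_ge hc hc1 he1
      _ = c := Real.rpow_one c
  refine ⟨c ^ e, Real.rpow_pos_of_pos hc e, hce.trans hc1, fun ℓ hℓ hℓ1 => ?_⟩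
  obtain ⟨u, pr, hF, hE, hfloor⟩ := hfam ℓ hℓ hℓ1
  refine ⟨u, pr, hF, hE, fun t ht => ?_⟩
  have hℓ2 : 0 < ℓ ^ (2 : ℝ) := Real.rpow_pos_of_pos hℓ _
  have ht' : t ∈ Ioo 0 (c * ℓ ^ (2 : ℝ)) :=
    ⟨ht.1, ht.2.trans_le (mul_le_mul_of_nonneg_right hce hℓ2.le)⟩
  have hwin1 : c * ℓ ^ (2 : ℝ) ≤ 1 := by
    calc c * ℓ ^ (2 : ℝ) ≤ 1 * 1 :=
          mul_le_mul hc1 (Real.rpow_le_one hℓ.le hℓ1 (by norm_num)) hℓ2.le zero_le_one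
      _ = 1 := one_mul _
  have ht1 : t < 1 := ht'.2.trans_le hwin1
  have hfl := hfloor t ht'
  have hen : ∫⁻ x, ‖u t x‖ₑ ^ 2 ≤ 1 :=
    (frame_lintegral_sq_le_energy0 zero_le_one hF ⟨ht.1.le, ht1.le⟩).trans hE
  have hmeas : AEMeasurable (fun x => ‖u t x‖ₑ) volume :=
    (frame_aestronglyMeasurable hF ⟨ht.1, ht1⟩).enorm
  have hI := lintegral_rpow_three_le_interp volume hmeas hp
  -- `∫|u|² ≤ 1` (real exponent form)
  have hen' : ∫⁻ x, ‖u t x‖ₑ ^ (2 : ℝ) ≤ 1 := by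
    have e2 : ∫⁻ x, ‖u t x‖ₑ ^ (2 : ℝ) = ∫⁻ x, ‖u t x‖ₑ ^ 2 :=
      lintegral_congr fun x => by rw [show (2 : ℝ) = ((2 : ℕ) : ℝ) by norm_num, ENNReal.rpow_natCast]
    rw [e2]; exact hen
  -- `‖u‖₃³ = ∫|u|³`, `∫|u|^p = ‖u‖_p^p`
  have e3 : eLpNorm (u t) 3 volume ^ (3 : ℝ) = ∫⁻ x, ‖u t x‖ₑ ^ (3 : ℝ) := by
    have h := eLpNorm_rpow_eq_lintegral volume (u t) (p := 3) (by norm_num)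
    rwa [show ENNReal.ofReal (3 : ℝ) = 3 by norm_num] at h
  have ep : (∫⁻ x, ‖u t x‖ₑ ^ p) = eLpNorm (u t) (ENNReal.ofReal p) volume ^ p :=
    (eLpNorm_rpow_eq_lintegral volume (u t) hp0).symm
  -- `‖u‖₃³ ≤ ‖u‖_p^{p/(p-2)}`
  have hkey : eLpNorm (u t) 3 volume ^ (3 : ℝ) ≤
      eLpNorm (u t) (ENNReal.ofReal p) volume ^ (p / (p - 2)) := by
    calc eLpNorm (u t) 3 volume ^ (3 : ℝ) = ∫⁻ x, ‖u t x‖ₑ ^ (3 : ℝ) := e3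
      _ ≤ (∫⁻ x, ‖u t x‖ₑ ^ (2 : ℝ)) ^ ((p - 3) / (p - 2)) * (∫⁻ x, ‖u t x‖ₑ ^ p) ^ (1 / (p - 2)) := hI
      _ ≤ (1 : ℝ≥0∞) ^ ((p - 3) / (p - 2)) * (∫⁻ x, ‖u t x‖ₑ ^ p) ^ (1 / (p - 2)) := by
          gcongr
      _ = eLpNorm (u t) (ENNReal.ofReal p) volume ^ (p / (p - 2)) := by
          rw [ENNReal.one_rpow, one_mul, ep, ← ENNReal.rpow_mul, mul_one_div]
  -- raise to the power `(p-2)/p`: `‖u‖₃^e ≤ ‖u‖_p`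
  have hkey2 : eLpNorm (u t) 3 volume ^ e ≤ eLpNorm (u t) (ENNReal.ofReal p) volume := by
    have h := ENNReal.rpow_le_rpow hkey (div_nonneg hp2.le hp0.le : (0 : ℝ) ≤ (p - 2) / p)
    rw [← ENNReal.rpow_mul, ← ENNReal.rpow_mul] at h
    have x1 : (3 : ℝ) * ((p - 2) / p) = e := by rw [he]; ring
    have x2 : p / (p - 2) * ((p - 2) / p) = 1 := by field_simp
    rwa [x1, x2, ENNReal.rpow_one] at h
  -- the floor
  have hx0 : 0 ≤ c * ℓ ^ (-(1 / 2 : ℝ)) := by positivity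
  have efl : c ^ e * ℓ ^ (-(3 / 2 - 3 / p)) = (c * ℓ ^ (-(1 / 2 : ℝ))) ^ e := by
    rw [Real.mul_rpow hc.le (Real.rpow_nonneg hℓ.le _), ← Real.rpow_mul hℓ.le]
    congr 2
    rw [he]; field_simp; try ring
  calc ENNReal.ofReal (c ^ e * ℓ ^ (-(3 / 2 - 3 / p)))
      = ENNReal.ofReal (c * ℓ ^ (-(1 / 2 : ℝ))) ^ e := by
        rw [efl, ENNReal.ofReal_rpow_of_nonneg hx0 he0]
    _ ≤ eLpNorm (u t) 3 volume ^ e := ENNReal.rpow_le_rpow hfl he0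
    _ ≤ eLpNorm (u t) (ENNReal.ofReal p) volume := hkey2

/-- **The energy line is rigid in every mixed norm `L^q_t L^p_x`, `p > 3`**: no `(E₀, ν, T)`-uniform
bound on `∫₀ᵀ ‖u‖_p^q` over Schwartz-class data holds strictly above the energy line
`2/q + 3/p = 3/2`. -/
theorem not_quantBound_of_three_lt {p q : ℝ} (hp : 3 < p) (hq : 0 < q)
    (hline : 2 / q + 3 / p < 3 / 2) : ¬ QuantBound (ENNReal.ofReal p) q :=
  not_quantBound_above_energyLine hq (lpPersistence_of_three_lt hp) hline

/--
info: 'Summit.NavierStokesRegularity.NavierStokesRegularity.Theorems.L3TimeExponentPincerEnergyLineAllP.not_quantBound_of_three_lt' depends on axioms: [propext,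
 Classical.choice,
 Quot.sound]
-/
#guard_msgs in
#print axioms not_quantBound_of_three_lt

end Summit.NavierStokesRegularity.NavierStokesRegularity.Theorems.L3TimeExponentPincerEnergyLineAllP

end
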